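/-
Origin: expansion seat `planner-pub-hodgecm-mc-glue-1-g11-0`, handover #SG38 2026-08-20T16:55:47Z md5 c2e792fda159 (REPLACE; pre md5 2bc6dd7f5751 → new md5 c2e792fda159; 126 l.; (μ4) scope-guard rewrite of the RUN-55 installed file; family glue-1; compiled ok 0 proof-hole) (`HOME/mc/pub-hodgecm-mc-glue-1-g11/stage56/HodgeCM/Model/E2InstanceOGR21AEPISTRDM.lean`, md5 c2e792fda159, 126 lines);
landed by the second packager p2 gen 10 (p2-g10) in gate run 56 REPLACES the earlier landed copy of `HodgeCM/Model/E2InstanceOGR21AEPISTRDM.lean` (seat copy carried the packager Origin header of an earlier run (stripped)).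
-/
/-
Origin: CONSTRUCTION seat `planner-pub-hodgecm-mc-glue-1-g10-0` (unit pub-hodgecm-mc-glue-1-g10, gen 10 of mc-glue-1, node E ASSEMBLER),
generated from glue-1's #397D `HodgeCM/Model/E2InstanceOGR21AEPISTRD.lean` (227275bf55c1) by `tools/gen_ogistrdm.py`; KERNEL only: 1 theorem,
0 defs; intended closure {propext, Classical.choice, Quot.sound}.  theta-3's (TD) `μ♯` child: #397D with its guarded (J-μ) identity `hΔ₁`
discharged by theta-3 RUN-45 (TD) `ArchSideTerm.hΔ₁_GOG_muSharp` at `ArchSideTerm.muSharp μ` (`Model/ArchSlotDeltaDischarge`); a closing-chain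
leaf beside E — record status is the lead's ruling, not this file's claim.
-/
import Summits.HodgeConjecture.HodgeCM.Model.E2InstanceOGR21AEPISTRD
import Summits.HodgeConjecture.HodgeCM.Model.ArchSlotDeltaDischarge


noncomputable section

open scoped TensorProduct InnerProductSpace Matrix

open Literature.NumberTheory.Automorphic Literature.NumberTheory.Weil1964
open Literature.NumberTheory.GelbartRogawski1991.UnitaryDualPair
open HodgeCM.Adelic HodgeCM.PerL34
open scoped Classical
open Literature.Geometry.ComplexHyperbolic.BallModel (U21 x₀ stabilizerEquivK21)
open Literature.NumberTheory.Automorphic.U21 (K21 matA sclD)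




/-!
# E2InstanceOGR21AEPISTRDM — the full (R1) child with (J-μ)₁ discharged at theta-3's adapter `μ♯`

`perL_picardCM_r21AEOGISTRDM` = `perL_picardCM_r21AEOGISTRD` (#397D, 17 binder groups) fed, exactly as theta-3-g13's (TD) recipe prescribes
(`Model/ArchSlotDeltaDischarge`, RUN 45; STATUS 07:5xZ «an E-shaped term taking (μ, hΔ₁, hΔ₂, hΔ₃) is fed (μ♯, hΔ₁_GOG_muSharp …,
hΔ₂_GOG_muSharp μ hΔ₂, hΔ₃_GOG_muSharp μ hΔ₃)»), with
`μ := ArchSideTerm.muSharp μ` (`μ♯ c := Function.update (μ c) 1 (μ c 0 + slotDelta c.D)`),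
`hΔ₁ := ArchSideTerm.hΔ₁_GOG_muSharp @hGR @hGR₀ @hGR₁ @hGR₂ @hGR₃ @μ` (HYPOTHESIS-FREE: (TT) `slotTypeVec_one_sub_zero_eq_slotDelta` fed by the
guard's `hG_GOG`, `hpos_GOG`), `hΔ₂ := ArchSideTerm.hΔ₂_GOG_muSharp … @μ hΔ₂`, `hΔ₃ := ArchSideTerm.hΔ₃_GOG_muSharp … @μ hΔ₃` (the update at `1`
does not touch `0, 2, 3`).  Binder groups 17 → 16: `hA W hGR hGR₀ hGR₁ hGR₂ hGR₃ μ hΔ₂ hΔ₃ hR hΘ gen12 real34 hyp12 hyp34` — `μ hΔ₂ hΔ₃` keep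
their texts VERBATIM (stated at `μ`); the texts of `hΘ gen12 real34 hyp12 hyp34` are #397D's with `μ ↦ ArchSideTerm.muSharp μ` and the pin's proof
arguments `@μ hΔ₁ hΔ₂ hΔ₃ ↦ @(ArchSideTerm.muSharp μ) (ArchSideTerm.hΔ₁_GOG_muSharp …) (ArchSideTerm.hΔ₂_GOG_muSharp … hΔ₂) (ArchSideTerm.hΔ₃_GOG_muSharp
… hΔ₃)` (forced: the pin `SInstance.SROGTC` is now instantiated at `μ♯`); conclusion `Universe.PerL` unchanged; proof = ONE application of
`perL_picardCM_r21AEOGISTRD`.  ADDITIVE LEAF; no new definition, record or cite enters; nothing of PerL ∕ QW8 is claimed.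
-/

namespace HodgeCM

namespace Model

open HodgeCM.Model.ArchSideTerm
open HodgeCM.Universe (AdelicThetaCore AdelicThetaCore₀ SideData ThetaModel ModelAxiomsPerL)
open Literature.AlgebraicGeometry.HodgeTheory
open Literature.AlgebraicGeometry.ComplexMultiplication (Shimura1998_Thm3_isogenousPower Shimura1998_Thm2_Cor)
open Literature.NumberTheory.Automorphic.PicardCM
open Literature.NumberTheory.Transcendental (Arapura2012_Cor_15_4_6)
open HodgeCM.CMTypeOps (inflate)
open HodgeCM.Model.SupplyResidual (ClassSupplyPackN)
open HodgeCM.Model.ThetaSpace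

variable (hHD : exists_isReal_hodgeModel) (hI : hodgePQ_independent_of_hodgeModel)
  (h₁ : BallQuotientUniformised)  (h₃ : CMAbelianVarietyEigenbasisRealised)

/-- **THE FULL (R1) CHILD AT `μ♯`** ((J-μ)₁ discharged; 16 binder groups `hA W hGR hGR₀ hGR₁ hGR₂ hGR₃ μ hΔ₂ hΔ₃ hR hΘ gen12 real34 hyp12
hyp34`, the last five re-texted `μ ↦ ArchSideTerm.muSharp μ`). -/
theorem perL_picardCM_r21AEOGISTRDM (hA : Arapura2012_Cor_15_4_6)
    (W : ∀ {L : CMField} {ι₁ : L →+* ℂ} (V : HermSpace3 L ι₁) (c : SeesawCtx L), WmInput V c.D)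
    (hGR : ∀ {L : CMField} {ι₁ : L →+* ℂ} (V : HermSpace3 L ι₁) (c : SeesawCtx L),
      (cmSplittingDatum (L : Type) finProdFinEquiv (frameD V) (frameD_real V) (frameD_ne V) (dW c.D) (dW_real c.D)
        (dW_ne c.D)).CompatibleSplitting)
    (hGR₀ : ∀ {L : CMField} {ι₁ : L →+* ℂ} (V : HermSpace3 L ι₁) (c : SeesawCtx L),
      (cmSplittingDatum (L : Type) (e₁) (frameD V) (frameD_real V) (frameD_ne V) (lineVec (L : Type) (dW c.D 0))
        (fun _ => dW_real c.D 0) (fun _ => dW_ne c.D 0)).CompatibleSplitting)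
    (hGR₁ : ∀ {L : CMField} {ι₁ : L →+* ℂ} (V : HermSpace3 L ι₁) (c : SeesawCtx L),
      (cmSplittingDatum (L : Type) (e₁) (frameD V) (frameD_real V) (frameD_ne V) (lineVec (L : Type) (dW c.D 1))
        (fun _ => dW_real c.D 1) (fun _ => dW_ne c.D 1)).CompatibleSplitting)
    (hGR₂ : ∀ {L : CMField} {ι₁ : L →+* ℂ} (V : HermSpace3 L ι₁) (c : SeesawCtx L),
      (cmSplittingDatum (L : Type) (e₁) (frameD V) (frameD_real V) (frameD_ne V) (lineVec (L : Type) (dW' c.D 0))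
        (fun _ => dW'_real c.D 0) (fun _ => dW'_ne c.D 0)).CompatibleSplitting)
    (hGR₃ : ∀ {L : CMField} {ι₁ : L →+* ℂ} (V : HermSpace3 L ι₁) (c : SeesawCtx L),
      (cmSplittingDatum (L : Type) (e₁) (frameD V) (frameD_real V) (frameD_ne V) (lineVec (L : Type) (dW' c.D 1))
        (fun _ => dW'_real c.D 1) (fun _ => dW'_ne c.D 1)).CompatibleSplitting)
    (μ : ∀ {L : CMField}, SeesawCtx L → Fin 4 → NumberField.InfinitePlace L → ℤ)
    (hΔ₂ : ∀ {L : CMField} {ι₁ : L →+* ℂ} (V : HermSpace3 L ι₁) (c : SeesawCtx L), ∀ hc : SInstance.GOG V c,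
      slotTypeVec V c (hGR V c) (hGR₀ V c) (hGR₁ V c) (hGR₂ V c) (hGR₃ V c) (SInstance.hG_GOG V c hc) 2 -
        slotTypeVec V c (hGR V c) (hGR₀ V c) (hGR₁ V c) (hGR₂ V c) (hGR₃ V c) (SInstance.hG_GOG V c hc) 0 = μ c 2 - μ c 0)
    (hΔ₃ : ∀ {L : CMField} {ι₁ : L →+* ℂ} (V : HermSpace3 L ι₁) (c : SeesawCtx L), ∀ hc : SInstance.GOG V c,
      slotTypeVec V c (hGR V c) (hGR₀ V c) (hGR₁ V c) (hGR₂ V c) (hGR₃ V c) (SInstance.hG_GOG V c hc) 3 -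
        slotTypeVec V c (hGR V c) (hGR₀ V c) (hGR₁ V c) (hGR₂ V c) (hGR₃ V c) (SInstance.hG_GOG V c hc) 0 = μ c 3 - μ c 0)
    (hR : DeligneMilne1982_Thm_6_20_full)
    (hΘ : ∀ {L : CMField} {ι₁ : L →+* ℂ} (V : HermSpace3 L ι₁) (c : SeesawCtx L),
      (thetaModelOf hHD hI h₁ (cmAbelianVarietyRealised_of_eigenbasis hHD hI h₃) (orientBitι L ι₁) (embOf hHD hI h₁ (cmAbelianVarietyRealised_of_eigenbasis hHD hI h₃)) (coverOf hHD hI h₁ (cmAbelianVarietyRealised_of_eigenbasis hHD hI h₃) hA) (wmOfInput W) (thetaOf _ (thetaClassInputOf _ (fun V c => thetaSpaceInputOf hHD hI h₁ (cmAbelianVarietyRealised_of_eigenbasis hHD hI h₃) (SInstance.SROGTC @hGR @hGR₀ @hGR₁ @hGR₂ @hGR₃ (ArchSideTerm.muSharp @μ) (ArchSideTerm.hΔ₁_GOG_muSharp @hGR @hGR₀ @hGR₁ @hGR₂ @hGR₃ @μ) (ArchSideTerm.hΔ₂_GOG_muSharp @hGR @hGR₀ @hGR₁ @hGR₂ @hGR₃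 @μ hΔ₂) (ArchSideTerm.hΔ₃_GOG_muSharp @hGR @hGR₀ @hGR₁ @hGR₂ @hGR₃ @μ hΔ₃)) V c))) (d12Of (ArchSideTerm.muSharp @μ)) (d34Of (ArchSideTerm.muSharp @μ))).GoodCtx ι₁ c → Module.finrank ℚ c.K = 6 ∧ IsNormalClosure ℚ c.K L ∧ (Module.finrank ℚ L = 24 ∨ Module.finrank ℚ L = 48) →
      (NumberField.InfinitePlace.mk ι₁).embedding = ι₁ →
      ∀ i : Fin 4, ∃ Γ₀ : Level V, ∀ Γ ≤ Γ₀,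
        ∃ D : CommonReflexInput c.K (c.Ψ i) c.σ,
          (thetaModelOf hHD hI h₁ (cmAbelianVarietyRealised_of_eigenbasis hHD hI h₃) (orientBitι L ι₁) (embOf hHD hI h₁ (cmAbelianVarietyRealised_of_eigenbasis hHD hI h₃)) (coverOf hHD hI h₁ (cmAbelianVarietyRealised_of_eigenbasis hHD hI h₃) hA) (wmOfInput W) (thetaOf _ (thetaClassInputOf _ (fun V c => thetaSpaceInputOf hHD hI h₁ (cmAbelianVarietyRealised_of_eigenbasis hHD hI h₃) (SInstance.SROGTC @hGR @hGR₀ @hGR₁ @hGR₂ @hGR₃ (ArchSideTerm.muSharp @μ) (ArchSideTerm.hΔ₁_GOG_muSharp @hGR @hGR₀ @hGR₁ @hGR₂ @hGR₃ @μ) (ArchSideTerm.hΔ₂_GOG_muSharp @hGR @hGR₀ @hGR₁ @hGR₂ @hGR₃ @μ hΔ₂) (ArchSideTerm.hΔ₃_GOG_muSharp @hGR @hGR₀ @hGR₁ @hGR₂ @hGR₃ @μ hΔ₃)) V c))) (d12Of (ArchSideTerm.muSharp @μ)) (d34Of (ArchSideTerm.muSharp @μ))).Theta V c i Γ ⊆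
            Submodule.span ℂ (D.surfaceClasses hHD hI h₁ (cmAbelianVarietyRealised_of_eigenbasis hHD hI h₃) V Γ))
    (gen12 : ∀ {L : CMField} {ι₁ : L →+* ℂ} (V : HermSpace3 L ι₁) (c : SeesawCtx L),
      (thetaModelOf hHD hI h₁ (cmAbelianVarietyRealised_of_eigenbasis hHD hI h₃) (orientBitι L ι₁) (embOf hHD hI h₁ (cmAbelianVarietyRealised_of_eigenbasis hHD hI h₃)) (coverOf hHD hI h₁ (cmAbelianVarietyRealised_of_eigenbasis hHD hI h₃) hA) (wmOfInput W) (thetaOf _ (thetaClassInputOf _ (fun V c => thetaSpaceInputOf hHD hI h₁ (cmAbelianVarietyRealised_of_eigenbasis hHD hI h₃) (SInstance.SROGTC @hGR @hGR₀ @hGR₁ @hGR₂ @hGR₃ (ArchSideTerm.muSharp @μ) (ArchSideTerm.hΔ₁_GOG_muSharp @hGR @hGR₀ @hGR₁ @hGR₂ @hGR₃ @μ) (ArchSideTerm.hΔ₂_GOG_muSharp @hGR @hGR₀ @hGR₁ @hGR₂ @hGR₃ @μ hΔ₂) (ArchSideTerm.hΔ₃_GOG_muSharp @hGR @hGR₀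 @hGR₁ @hGR₂ @hGR₃ @μ hΔ₃)) V c))) (d12Of (ArchSideTerm.muSharp @μ)) (d34Of (ArchSideTerm.muSharp @μ))).GoodCtx ι₁ c → Module.finrank ℚ c.K = 6 ∧ IsNormalClosure ℚ c.K L ∧ (Module.finrank ℚ L = 24 ∨ Module.finrank ℚ L = 48) →
      (NumberField.InfinitePlace.mk ι₁).embedding = ι₁ →
      Nonempty ((thetaModelOf hHD hI h₁ (cmAbelianVarietyRealised_of_eigenbasis hHD hI h₃) (orientBitι L ι₁) (embOf hHD hI h₁ (cmAbelianVarietyRealised_of_eigenbasis hHD hI h₃)) (coverOf hHD hI h₁ (cmAbelianVarietyRealised_of_eigenbasis hHD hI h₃) hA) (wmOfInput W) (thetaOf _ (thetaClassInputOf _ (fun V c => thetaSpaceInputOf hHD hI h₁ (cmAbelianVarietyRealised_of_eigenbasis hHD hI h₃) (SInstance.SROGTC @hGR @hGR₀ @hGR₁ @hGR₂ @hGR₃ (ArchSideTerm.muSharp @μ) (ArchSideTerm.hΔ₁_GOG_muSharp @hGR @hGR₀ @hGR₁ @hGR₂ @hGR₃ @μ) (ArchSideTerm.hΔ₂_GOG_muSharp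 @hGR @hGR₀ @hGR₁ @hGR₂ @hGR₃ @μ hΔ₂) (ArchSideTerm.hΔ₃_GOG_muSharp @hGR @hGR₀ @hGR₁ @hGR₂ @hGR₃ @μ hΔ₃)) V c))) (d12Of (ArchSideTerm.muSharp @μ)) (d34Of (ArchSideTerm.muSharp @μ))).Gen12FunBridge V c))
    (real34 : ∀ {L : CMField} {ι₁ : L →+* ℂ} (V : HermSpace3 L ι₁) (c : SeesawCtx L),
      (thetaModelOf hHD hI h₁ (cmAbelianVarietyRealised_of_eigenbasis hHD hI h₃) (orientBitι L ι₁) (embOf hHD hI h₁ (cmAbelianVarietyRealised_of_eigenbasis hHD hI h₃)) (coverOf hHD hI h₁ (cmAbelianVarietyRealised_of_eigenbasis hHD hI h₃) hA) (wmOfInput W) (thetaOf _ (thetaClassInputOf _ (fun V c => thetaSpaceInputOf hHD hI h₁ (cmAbelianVarietyRealised_of_eigenbasis hHD hI h₃) (SInstance.SROGTC @hGR @hGR₀ @hGR₁ @hGR₂ @hGR₃ (ArchSideTerm.muSharp @μ) (ArchSideTerm.hΔ₁_GOG_muSharp @hGR @hGR₀ @hGR₁ @hGR₂ @hGR₃ @μ)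 (ArchSideTerm.hΔ₂_GOG_muSharp @hGR @hGR₀ @hGR₁ @hGR₂ @hGR₃ @μ hΔ₂) (ArchSideTerm.hΔ₃_GOG_muSharp @hGR @hGR₀ @hGR₁ @hGR₂ @hGR₃ @μ hΔ₃)) V c))) (d12Of (ArchSideTerm.muSharp @μ)) (d34Of (ArchSideTerm.muSharp @μ))).GoodCtx ι₁ c → Module.finrank ℚ c.K = 6 ∧ IsNormalClosure ℚ c.K L ∧ (Module.finrank ℚ L = 24 ∨ Module.finrank ℚ L = 48) →
      (NumberField.InfinitePlace.mk ι₁).embedding = ι₁ →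
      Nonempty ((thetaModelOf hHD hI h₁ (cmAbelianVarietyRealised_of_eigenbasis hHD hI h₃) (orientBitι L ι₁) (embOf hHD hI h₁ (cmAbelianVarietyRealised_of_eigenbasis hHD hI h₃)) (coverOf hHD hI h₁ (cmAbelianVarietyRealised_of_eigenbasis hHD hI h₃) hA) (wmOfInput W) (thetaOf _ (thetaClassInputOf _ (fun V c => thetaSpaceInputOf hHD hI h₁ (cmAbelianVarietyRealised_of_eigenbasis hHD hI h₃) (SInstance.SROGTC @hGR @hGR₀ @hGR₁ @hGR₂ @hGR₃ (ArchSideTerm.muSharp @μ) (ArchSideTerm.hΔ₁_GOG_muSharp @hGR @hGR₀ @hGR₁ @hGR₂ @hGR₃ @μ) (ArchSideTerm.hΔ₂_GOG_muSharp @hGR @hGR₀ @hGR₁ @hGR₂ @hGR₃ @μ hΔ₂) (ArchSideTerm.hΔ₃_GOG_muSharp @hGR @hGR₀ @hGR₁ @hGR₂ @hGR₃ @μ hΔ₃)) V c))) (d12Of (ArchSideTerm.muSharp @μ)) (d34Of (ArchSideTerm.muSharp @μ))).Real34FunBridge V c))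
    (hyp12 : ∀ {L : CMField} {ι₁ : L →+* ℂ} (V : HermSpace3 L ι₁) (c : SeesawCtx L),
      (thetaModelOf hHD hI h₁ (cmAbelianVarietyRealised_of_eigenbasis hHD hI h₃) (orientBitι L ι₁) (embOf hHD hI h₁ (cmAbelianVarietyRealised_of_eigenbasis hHD hI h₃)) (coverOf hHD hI h₁ (cmAbelianVarietyRealised_of_eigenbasis hHD hI h₃) hA) (wmOfInput W) (thetaOf _ (thetaClassInputOf _ (fun V c => thetaSpaceInputOf hHD hI h₁ (cmAbelianVarietyRealised_of_eigenbasis hHD hI h₃) (SInstance.SROGTC @hGR @hGR₀ @hGR₁ @hGR₂ @hGR₃ (ArchSideTerm.muSharp @μ) (ArchSideTerm.hΔ₁_GOG_muSharp @hGR @hGR₀ @hGR₁ @hGR₂ @hGR₃ @μ) (ArchSideTerm.hΔ₂_GOG_muSharp @hGR @hGR₀ @hGR₁ @hGR₂ @hGR₃ @μ hΔ₂) (ArchSideTerm.hΔ₃_GOG_muSharp @hGR @hGR₀ @hGR₁ @hGR₂ @hGR₃ @μ hΔ₃)) V c))) (d12Of (ArchSideTerm.muSharp @μ)) (d34Of (ArchSideTerm.muSharp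 @μ))).GoodCtx ι₁ c → Module.finrank ℚ c.K = 6 ∧ IsNormalClosure ℚ c.K L ∧ (Module.finrank ℚ L = 24 ∨ Module.finrank ℚ L = 48) →
      (NumberField.InfinitePlace.mk ι₁).embedding = ι₁ →
      Nonempty (((coreOf _ (embOf hHD hI h₁ (cmAbelianVarietyRealised_of_eigenbasis hHD hI h₃)) (coverOf hHD hI h₁ (cmAbelianVarietyRealised_of_eigenbasis hHD hI h₃) hA) (wmOfInput W) (thetaOf _ (thetaClassInputOf _ (fun V c => thetaSpaceInputOf hHD hI h₁ (cmAbelianVarietyRealised_of_eigenbasis hHD hI h₃) (SInstance.SROGTC @hGR @hGR₀ @hGR₁ @hGR₂ @hGR₃ (ArchSideTerm.muSharp @μ) (ArchSideTerm.hΔ₁_GOG_muSharp @hGR @hGR₀ @hGR₁ @hGR₂ @hGR₃ @μ) (ArchSideTerm.hΔ₂_GOG_muSharp @hGR @hGR₀ @hGR₁ @hGR₂ @hGR₃ @μ hΔ₂) (ArchSideTerm.hΔ₃_GOG_muSharp @hGR @hGR₀ @hGR₁ @hGR₂ @hGR₃ @μ hΔ₃)) V c)))).toCore (orientBitι L ι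₁)).HypSmoothCore12
        (((coreOf _ (embOf hHD hI h₁ (cmAbelianVarietyRealised_of_eigenbasis hHD hI h₃)) (coverOf hHD hI h₁ (cmAbelianVarietyRealised_of_eigenbasis hHD hI h₃) hA) (wmOfInput W) (thetaOf _ (thetaClassInputOf _ (fun V c => thetaSpaceInputOf hHD hI h₁ (cmAbelianVarietyRealised_of_eigenbasis hHD hI h₃) (SInstance.SROGTC @hGR @hGR₀ @hGR₁ @hGR₂ @hGR₃ (ArchSideTerm.muSharp @μ) (ArchSideTerm.hΔ₁_GOG_muSharp @hGR @hGR₀ @hGR₁ @hGR₂ @hGR₃ @μ) (ArchSideTerm.hΔ₂_GOG_muSharp @hGR @hGR₀ @hGR₁ @hGR₂ @hGR₃ @μ hΔ₂) (ArchSideTerm.hΔ₃_GOG_muSharp @hGR @hGR₀ @hGR₁ @hGR₂ @hGR₃ @μ hΔ₃)) V c)))).toCore (orientBitι L ι₁)).side12 (d12Of (ArchSideTerm.muSharp @μ))) (((coreOf _ (embOf hHD hI h₁ (cmAbelianVarietyRealised_of_eigenbasis hHD hI h₃)) (coverOf hHD hI h₁ (cmAbelianVarietyRealised_of_eigenbasis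 hHD hI h₃) hA) (wmOfInput W) (thetaOf _ (thetaClassInputOf _ (fun V c => thetaSpaceInputOf hHD hI h₁ (cmAbelianVarietyRealised_of_eigenbasis hHD hI h₃) (SInstance.SROGTC @hGR @hGR₀ @hGR₁ @hGR₂ @hGR₃ (ArchSideTerm.muSharp @μ) (ArchSideTerm.hΔ₁_GOG_muSharp @hGR @hGR₀ @hGR₁ @hGR₂ @hGR₃ @μ) (ArchSideTerm.hΔ₂_GOG_muSharp @hGR @hGR₀ @hGR₁ @hGR₂ @hGR₃ @μ hΔ₂) (ArchSideTerm.hΔ₃_GOG_muSharp @hGR @hGR₀ @hGR₁ @hGR₂ @hGR₃ @μ hΔ₃)) V c)))).toCore (orientBitι L ι₁)).side34 (d34Of (ArchSideTerm.muSharp @μ)))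
        ((((coreOf _ (embOf hHD hI h₁ (cmAbelianVarietyRealised_of_eigenbasis hHD hI h₃)) (coverOf hHD hI h₁ (cmAbelianVarietyRealised_of_eigenbasis hHD hI h₃) hA) (wmOfInput W) (thetaOf _ (thetaClassInputOf _ (fun V c => thetaSpaceInputOf hHD hI h₁ (cmAbelianVarietyRealised_of_eigenbasis hHD hI h₃) (SInstance.SROGTC @hGR @hGR₀ @hGR₁ @hGR₂ @hGR₃ (ArchSideTerm.muSharp @μ) (ArchSideTerm.hΔ₁_GOG_muSharp @hGR @hGR₀ @hGR₁ @hGR₂ @hGR₃ @μ) (ArchSideTerm.hΔ₂_GOG_muSharp @hGR @hGR₀ @hGR₁ @hGR₂ @hGR₃ @μ hΔ₂) (ArchSideTerm.hΔ₃_GOG_muSharp @hGR @hGR₀ @hGR₁ @hGR₂ @hGR₃ @μ hΔ₃)) V c)))).toCore (orientBitι L ι₁)).analyticKM (((coreOf _ (embOf hHD hI h₁ (cmAbelianVarietyRealised_of_eigenbasis hHD hI h₃)) (coverOf hHD hI h₁ (cmAbelianVarietyRealised_of_eigenbasis hHD hI h₃) hA) (wmOfInput W) (thetaOf _ (thetaClassInputOf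 _ (fun V c => thetaSpaceInputOf hHD hI h₁ (cmAbelianVarietyRealised_of_eigenbasis hHD hI h₃) (SInstance.SROGTC @hGR @hGR₀ @hGR₁ @hGR₂ @hGR₃ (ArchSideTerm.muSharp @μ) (ArchSideTerm.hΔ₁_GOG_muSharp @hGR @hGR₀ @hGR₁ @hGR₂ @hGR₃ @μ) (ArchSideTerm.hΔ₂_GOG_muSharp @hGR @hGR₀ @hGR₁ @hGR₂ @hGR₃ @μ hΔ₂) (ArchSideTerm.hΔ₃_GOG_muSharp @hGR @hGR₀ @hGR₁ @hGR₂ @hGR₃ @μ hΔ₃)) V c)))).toCore (orientBitι L ι₁)).side12 (d12Of (ArchSideTerm.muSharp @μ)))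
          (((coreOf _ (embOf hHD hI h₁ (cmAbelianVarietyRealised_of_eigenbasis hHD hI h₃)) (coverOf hHD hI h₁ (cmAbelianVarietyRealised_of_eigenbasis hHD hI h₃) hA) (wmOfInput W) (thetaOf _ (thetaClassInputOf _ (fun V c => thetaSpaceInputOf hHD hI h₁ (cmAbelianVarietyRealised_of_eigenbasis hHD hI h₃) (SInstance.SROGTC @hGR @hGR₀ @hGR₁ @hGR₂ @hGR₃ (ArchSideTerm.muSharp @μ) (ArchSideTerm.hΔ₁_GOG_muSharp @hGR @hGR₀ @hGR₁ @hGR₂ @hGR₃ @μ) (ArchSideTerm.hΔ₂_GOG_muSharp @hGR @hGR₀ @hGR₁ @hGR₂ @hGR₃ @μ hΔ₂) (ArchSideTerm.hΔ₃_GOG_muSharp @hGR @hGR₀ @hGR₁ @hGR₂ @hGR₃ @μ hΔ₃)) V c)))).toCore (orientBitι L ι₁)).side34 (d34Of (ArchSideTerm.muSharp @μ)))).toAnalytic) V c (ℓ := linOfInput W V c)))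
    (hyp34 : ∀ {L : CMField} {ι₁ : L →+* ℂ} (V : HermSpace3 L ι₁) (c : SeesawCtx L),
      (thetaModelOf hHD hI h₁ (cmAbelianVarietyRealised_of_eigenbasis hHD hI h₃) (orientBitι L ι₁) (embOf hHD hI h₁ (cmAbelianVarietyRealised_of_eigenbasis hHD hI h₃)) (coverOf hHD hI h₁ (cmAbelianVarietyRealised_of_eigenbasis hHD hI h₃) hA) (wmOfInput W) (thetaOf _ (thetaClassInputOf _ (fun V c => thetaSpaceInputOf hHD hI h₁ (cmAbelianVarietyRealised_of_eigenbasis hHD hI h₃) (SInstance.SROGTC @hGR @hGR₀ @hGR₁ @hGR₂ @hGR₃ (ArchSideTerm.muSharp @μ) (ArchSideTerm.hΔ₁_GOG_muSharp @hGR @hGR₀ @hGR₁ @hGR₂ @hGR₃ @μ) (ArchSideTerm.hΔ₂_GOG_muSharp @hGR @hGR₀ @hGR₁ @hGR₂ @hGR₃ @μ hΔ₂) (ArchSideTerm.hΔ₃_GOG_muSharp @hGR @hGR₀ @hGR₁ @hGR₂ @hGR₃ @μ hΔ₃)) V c))) (d12Of (ArchSideTerm.muSharp @μ)) (d34Of (ArchSideTerm.muSharp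 @μ))).GoodCtx ι₁ c → Module.finrank ℚ c.K = 6 ∧ IsNormalClosure ℚ c.K L ∧ (Module.finrank ℚ L = 24 ∨ Module.finrank ℚ L = 48) →
      (NumberField.InfinitePlace.mk ι₁).embedding = ι₁ →
      Nonempty (((coreOf _ (embOf hHD hI h₁ (cmAbelianVarietyRealised_of_eigenbasis hHD hI h₃)) (coverOf hHD hI h₁ (cmAbelianVarietyRealised_of_eigenbasis hHD hI h₃) hA) (wmOfInput W) (thetaOf _ (thetaClassInputOf _ (fun V c => thetaSpaceInputOf hHD hI h₁ (cmAbelianVarietyRealised_of_eigenbasis hHD hI h₃) (SInstance.SROGTC @hGR @hGR₀ @hGR₁ @hGR₂ @hGR₃ (ArchSideTerm.muSharp @μ) (ArchSideTerm.hΔ₁_GOG_muSharp @hGR @hGR₀ @hGR₁ @hGR₂ @hGR₃ @μ) (ArchSideTerm.hΔ₂_GOG_muSharp @hGR @hGR₀ @hGR₁ @hGR₂ @hGR₃ @μ hΔ₂) (ArchSideTerm.hΔ₃_GOG_muSharp @hGR @hGR₀ @hGR₁ @hGR₂ @hGR₃ @μ hΔ₃)) V c)))).toCore (orientBitι L ι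₁)).HypSmoothCore34
        (((coreOf _ (embOf hHD hI h₁ (cmAbelianVarietyRealised_of_eigenbasis hHD hI h₃)) (coverOf hHD hI h₁ (cmAbelianVarietyRealised_of_eigenbasis hHD hI h₃) hA) (wmOfInput W) (thetaOf _ (thetaClassInputOf _ (fun V c => thetaSpaceInputOf hHD hI h₁ (cmAbelianVarietyRealised_of_eigenbasis hHD hI h₃) (SInstance.SROGTC @hGR @hGR₀ @hGR₁ @hGR₂ @hGR₃ (ArchSideTerm.muSharp @μ) (ArchSideTerm.hΔ₁_GOG_muSharp @hGR @hGR₀ @hGR₁ @hGR₂ @hGR₃ @μ) (ArchSideTerm.hΔ₂_GOG_muSharp @hGR @hGR₀ @hGR₁ @hGR₂ @hGR₃ @μ hΔ₂) (ArchSideTerm.hΔ₃_GOG_muSharp @hGR @hGR₀ @hGR₁ @hGR₂ @hGR₃ @μ hΔ₃)) V c)))).toCore (orientBitι L ι₁)).side12 (d12Of (ArchSideTerm.muSharp @μ))) (((coreOf _ (embOf hHD hI h₁ (cmAbelianVarietyRealised_of_eigenbasis hHD hI h₃)) (coverOf hHD hI h₁ (cmAbelianVarietyRealised_of_eigenbasis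 hHD hI h₃) hA) (wmOfInput W) (thetaOf _ (thetaClassInputOf _ (fun V c => thetaSpaceInputOf hHD hI h₁ (cmAbelianVarietyRealised_of_eigenbasis hHD hI h₃) (SInstance.SROGTC @hGR @hGR₀ @hGR₁ @hGR₂ @hGR₃ (ArchSideTerm.muSharp @μ) (ArchSideTerm.hΔ₁_GOG_muSharp @hGR @hGR₀ @hGR₁ @hGR₂ @hGR₃ @μ) (ArchSideTerm.hΔ₂_GOG_muSharp @hGR @hGR₀ @hGR₁ @hGR₂ @hGR₃ @μ hΔ₂) (ArchSideTerm.hΔ₃_GOG_muSharp @hGR @hGR₀ @hGR₁ @hGR₂ @hGR₃ @μ hΔ₃)) V c)))).toCore (orientBitι L ι₁)).side34 (d34Of (ArchSideTerm.muSharp @μ)))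
        ((((coreOf _ (embOf hHD hI h₁ (cmAbelianVarietyRealised_of_eigenbasis hHD hI h₃)) (coverOf hHD hI h₁ (cmAbelianVarietyRealised_of_eigenbasis hHD hI h₃) hA) (wmOfInput W) (thetaOf _ (thetaClassInputOf _ (fun V c => thetaSpaceInputOf hHD hI h₁ (cmAbelianVarietyRealised_of_eigenbasis hHD hI h₃) (SInstance.SROGTC @hGR @hGR₀ @hGR₁ @hGR₂ @hGR₃ (ArchSideTerm.muSharp @μ) (ArchSideTerm.hΔ₁_GOG_muSharp @hGR @hGR₀ @hGR₁ @hGR₂ @hGR₃ @μ) (ArchSideTerm.hΔ₂_GOG_muSharp @hGR @hGR₀ @hGR₁ @hGR₂ @hGR₃ @μ hΔ₂) (ArchSideTerm.hΔ₃_GOG_muSharp @hGR @hGR₀ @hGR₁ @hGR₂ @hGR₃ @μ hΔ₃)) V c)))).toCore (orientBitι L ι₁)).analyticKM (((coreOf _ (embOf hHD hI h₁ (cmAbelianVarietyRealised_of_eigenbasis hHD hI h₃)) (coverOf hHD hI h₁ (cmAbelianVarietyRealised_of_eigenbasis hHD hI h₃) hA) (wmOfInput W) (thetaOf _ (thetaClassInputOf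 _ (fun V c => thetaSpaceInputOf hHD hI h₁ (cmAbelianVarietyRealised_of_eigenbasis hHD hI h₃) (SInstance.SROGTC @hGR @hGR₀ @hGR₁ @hGR₂ @hGR₃ (ArchSideTerm.muSharp @μ) (ArchSideTerm.hΔ₁_GOG_muSharp @hGR @hGR₀ @hGR₁ @hGR₂ @hGR₃ @μ) (ArchSideTerm.hΔ₂_GOG_muSharp @hGR @hGR₀ @hGR₁ @hGR₂ @hGR₃ @μ hΔ₂) (ArchSideTerm.hΔ₃_GOG_muSharp @hGR @hGR₀ @hGR₁ @hGR₂ @hGR₃ @μ hΔ₃)) V c)))).toCore (orientBitι L ι₁)).side12 (d12Of (ArchSideTerm.muSharp @μ)))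
          (((coreOf _ (embOf hHD hI h₁ (cmAbelianVarietyRealised_of_eigenbasis hHD hI h₃)) (coverOf hHD hI h₁ (cmAbelianVarietyRealised_of_eigenbasis hHD hI h₃) hA) (wmOfInput W) (thetaOf _ (thetaClassInputOf _ (fun V c => thetaSpaceInputOf hHD hI h₁ (cmAbelianVarietyRealised_of_eigenbasis hHD hI h₃) (SInstance.SROGTC @hGR @hGR₀ @hGR₁ @hGR₂ @hGR₃ (ArchSideTerm.muSharp @μ) (ArchSideTerm.hΔ₁_GOG_muSharp @hGR @hGR₀ @hGR₁ @hGR₂ @hGR₃ @μ) (ArchSideTerm.hΔ₂_GOG_muSharp @hGR @hGR₀ @hGR₁ @hGR₂ @hGR₃ @μ hΔ₂) (ArchSideTerm.hΔ₃_GOG_muSharp @hGR @hGR₀ @hGR₁ @hGR₂ @hGR₃ @μ hΔ₃)) V c)))).toCore (orientBitι L ι₁)).side34 (d34Of (ArchSideTerm.muSharp @μ)))).toAnalytic) V c (ℓ := linOfInput W V c))) :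
     (picardCMUniverse hHD hI h₁ (cmAbelianVarietyRealised_of_eigenbasis hHD hI h₃)).PerL :=
  perL_picardCM_r21AEOGISTRD hHD hI h₁ h₃ hA W hGR hGR₀ hGR₁ hGR₂ hGR₃ (ArchSideTerm.muSharp @μ)
    (ArchSideTerm.hΔ₁_GOG_muSharp @hGR @hGR₀ @hGR₁ @hGR₂ @hGR₃ @μ) (ArchSideTerm.hΔ₂_GOG_muSharp @hGR @hGR₀ @hGR₁ @hGR₂ @hGR₃ @μ hΔ₂)
    (ArchSideTerm.hΔ₃_GOG_muSharp @hGR @hGR₀ @hGR₁ @hGR₂ @hGR₃ @μ hΔ₃) hR hΘ gen12 real34 hyp12 hyp34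

end Model

end HodgeCM
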